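import Summits.Ventures.DiscreteObjects.PP12.AffineSTD
import Literature.Combinatorics.Designs.MannSubsquareObstruction

/-!
# An STD₁[n;n] is a complete set of `n - 1` MOLS(n); a projective plane of order `n` yields `n - 1` MOLS(n) (kernel)
Framing: lottery ticket; floor = certified bounds/negative ranges.

Cell pub-namedobj (venture DiscreteObjects), target (M), designs gen 9.  PLAN-M (M-b): 'PP(12) — equivalently 11 MOLS(12)'.  The
forward half of that classical equivalence in the kernel, through the affine STD₁[n;n] of a flag (`AffineSTD`):
* **`mols_of_isSTD_one`** — for `π : STD.IncArray n n` with `STD.IsSTD 1 π` and a reference block class `j₀`, the squares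
  `L_j(i, b) = π i j ((π i j₀)⁻¹ b)` (`j ≠ j₀`; rows = point classes, columns = blocks of class `j₀`, symbols = blocks of class
  `j`) are Latin and pairwise orthogonal (`Literature…LatinSquares.IsLatinSquare` / `IsOrthogonalMate`): two points of different
  classes share ONE block, so a column or a pair of symbols never repeats;
* **`exists_complete_MOLS_of_plane`** — a finite projective plane of order `n` has a family of Latin squares of order `n` indexed
  by `{j : Fin n // j ≠ 0}` (`n - 1` of them), pairwise orthogonal; **`exists_eleven_MOLS_of_order12`** — a projective plane of
  order 12 would give 11 MOLS(12) (the record is `N(12) ≥ 5`, `FiveMOLS12`).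
The converse (n - 1 MOLS(n) ⇒ plane) is not formalised here.  Classical (Bose 1938); formalisation ours; no `sorry`.
-/

namespace Summit.Ventures.DiscreteObjects.MOLS

open Finset Function Configuration Summit.Ventures.DiscreteObjects.STD Summit.Ventures.DiscreteObjects.PP12
  Literature.Combinatorics.Designs.LatinSquares

section STDOne

variable {n : ℕ} (π : IncArray n n)

/-- In an STD₁ array two points of different classes share at most one block class. -/
theorem shared_class_unique (hπ : IsSTD 1 π) {i i' : Fin n} (hii' : i ≠ i') (a a' : Fin n) {j₁ j₂ : Fin n}
    (h1 : π i j₁ a = π i' j₁ a') (h2 : π i j₂ a = π i' j₂ a') : j₁ = j₂ := by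
  obtain ⟨j, hj⟩ := card_eq_one.mp (hπ.1 i i' hii' a a')
  have m1 : j₁ ∈ univ.filter (fun j => π i j a = π i' j a') := mem_filter.mpr ⟨mem_univ _, h1⟩
  have m2 : j₂ ∈ univ.filter (fun j => π i j a = π i' j a') := mem_filter.mpr ⟨mem_univ _, h2⟩
  rw [hj, mem_singleton] at m1 m2
  rw [m1, m2]

/-- the square of block class `j` read against the reference class `j₀`: `L_j(i, b) = π i j ((π i j₀)⁻¹ b)` -/
def sqOf (j₀ j : Fin n) : Fin n → Fin n → Fin n := fun i b => π i j ((π i j₀).symm b)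

/-- **Each `L_j`, `j ≠ j₀`, is a Latin square.** -/
theorem isLatinSquare_sqOf (hπ : IsSTD 1 π) {j₀ j : Fin n} (hj : j ≠ j₀) : IsLatinSquare (sqOf π j₀ j) := by
  refine ⟨fun i => ?_, fun b => ?_⟩
  · intro b b' h
    exact (π i j₀).symm.injective ((π i j).injective h)
  · intro i i' h
    by_contra hii'
    simp only [sqOf] at h
    have h0 : π i j₀ ((π i j₀).symm b) = π i' j₀ ((π i' j₀).symm b) := by simp
    exact hj (shared_class_unique π hπ hii' _ _ h h0)

/-- **`L_j` and `L_{j'}` are orthogonal for `j ≠ j'`.** -/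
theorem isOrthogonalMate_sqOf (hπ : IsSTD 1 π) {j₀ j j' : Fin n} (hjj' : j ≠ j') :
    IsOrthogonalMate (sqOf π j₀ j) (sqOf π j₀ j') := by
  rintro ⟨i, b⟩ ⟨i', b'⟩ h
  simp only [Prod.mk.injEq, sqOf] at h
  obtain ⟨h1, h2⟩ := h
  by_cases hii' : i = i'
  · subst hii'
    exact Prod.ext rfl ((π i j₀).symm.injective ((π i j).injective h1))
  · exact absurd (shared_class_unique π hπ hii' _ _ h1 h2) hjj'

/-- **An STD₁[n;n] is a complete set of MOLS:** the `n - 1` squares `L_j`, `j ≠ j₀`, are Latin and pairwise orthogonal. -/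
theorem mols_of_isSTD_one (hπ : IsSTD 1 π) (j₀ : Fin n) :
    (∀ j : {j : Fin n // j ≠ j₀}, IsLatinSquare (sqOf π j₀ j.1)) ∧
    ∀ j j' : {j : Fin n // j ≠ j₀}, j ≠ j' → IsOrthogonalMate (sqOf π j₀ j.1) (sqOf π j₀ j'.1) :=
  ⟨fun j => isLatinSquare_sqOf π hπ j.2, fun _ _ h => isOrthogonalMate_sqOf π hπ fun e => h (Subtype.ext e)⟩

/-- the index set `{j ≠ j₀}` has `n - 1` elements -/
theorem card_ne (j₀ : Fin n) : Fintype.card {j : Fin n // j ≠ j₀} = n - 1 := by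
  rw [Fintype.card_subtype_compl, Fintype.card_fin, Fintype.card_subtype_eq]

end STDOne

section Plane

open scoped Classical

variable {P L : Type*} [Membership P L] [ProjectivePlane P L] [Fintype P] [Fintype L]

/-- **A projective plane of order `n` yields `n - 1` MOLS of order `n`** (through the affine STD₁[n;n] of any flag). -/
theorem exists_complete_MOLS_of_plane {n : ℕ} (hn : ProjectivePlane.order P L = n) (h0 : 0 < n) :
    ∃ Ls : {j : Fin n // j ≠ ⟨0, h0⟩} → Fin n → Fin n → Fin n,
      (∀ j, IsLatinSquare (Ls j)) ∧ ∀ j j', j ≠ j' → IsOrthogonalMate (Ls j) (Ls j') := by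
  subst hn
  -- a flag
  obtain ⟨-, c, -, -, l, -, -, -, -, hcl, -, -, -, -⟩ := @ProjectivePlane.exists_config P L _ _
  obtain ⟨hL, hO⟩ := mols_of_isSTD_one (affArr hcl) (isSTD_one_affArr hcl) ⟨0, h0⟩
  exact ⟨fun j => sqOf (affArr hcl) ⟨0, h0⟩ j.1, hL, hO⟩

/-- **A projective plane of order 12 would give 11 MOLS(12)** (indexed by the 11 nonzero elements of `Fin 12`). -/
theorem exists_eleven_MOLS_of_order12 (h12 : ProjectivePlane.order P L = 12) :
    ∃ Ls : {j : Fin 12 // j ≠ 0} → Fin 12 → Fin 12 → Fin 12,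
      (∀ j, IsLatinSquare (Ls j)) ∧ ∀ j j', j ≠ j' → IsOrthogonalMate (Ls j) (Ls j') :=
  exists_complete_MOLS_of_plane h12 (by norm_num)

end Plane

end Summit.Ventures.DiscreteObjects.MOLS
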